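import Summits.MatrixMultiplication.OmegaCensus.DominoZ5Z5Data19S5
import Summits.MatrixMultiplication.OmegaCensus.DominoZ5Z5Refute19S5
import Summits.MatrixMultiplication.OmegaCensus.ThreeSetZ5Z5PlaneCertificate1
import HarnessLib

/-!
# Plane refutation check for `(1,9,12)@325`, hole class `σ = 5`

ω-census `pub-omega`, family (b3), seat pub-omega-group gen 37 (staged for the successor).  Framing: lottery ticket; floor = certified
bounds/negative ranges.  VALUE: data / kernel computations of the `ℤ₅²` stage of the census cell `(1,9,12)@325` of `ℤ₅ × ℤ₆₅`
(design `HOME/pub-omega-group-g37/DESIGN-1-9-12.md`); NOT progress on ω.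
-/

namespace Summit.MatrixMultiplication.OmegaCensus

namespace Z5Z5ThreeSet

open ZpZpDomino

set_option maxRecDepth 100000 in
set_option maxHeartbeats 4000000 in
/-- **Refutation check**: every listed plane row certificate passes (80 entries). [folklore] -/
theorem refChk19s5 : (refute19s5.all fun c => decide (c.2.1 < 25) &&
    refuteRowOK1 (excFlat19s5.getD c.1 []) 5 (c.2.1, c.2.2.1, zrow c.2.2.2.1 c.2.2.2.2)) = true := by decide +kernel

end Z5Z5ThreeSet

end Summit.MatrixMultiplication.OmegaCensus
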